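import Summits.BirchSwinnertonDyer.Rank1Residual.GaloisImage.KolyvaginLevelStructures
import HarnessLib

/-!
# The core rank is constant along the Kolyvagin levels, and the step `d ↦ d𝔮` on the dual side
# (Rubin, PCMI Ex. 2.1.4 / Thm. 2.5.2 and Prop. 2.6.1 / Cor. 2.6.2, at the residual level `m = 1`)
# (cell `b2b-bsdres`, team n1011, ROUTE-1 item R1-16, file 2 of 3 — lead ruling PLAN.md R5-29 (q);
# seat p11; skeleton `cells/n1011/skel/T-R1-16.md`)

HONEST FRAMING (verbatim for the cell): research route; prove what is provable now; shrink each hard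
class to its core with data; no claim beyond stated classes; nothing booked; no mark / label moved.
TOOL lemmas; theorems only — no definition, no named fact, no conjecture node.

Setting: `K` a number field, `M` a finite discrete `Γ_K`-module killed by `n` (a prime `p` in §7),
`inv` a Poitou–Tate family (`IsPerfect`, `SumLocalTermEqZero`, `SelmerComplement` — the content of the
tree's fact `poitouTate_selmerStructure_duality`), `𝓕` unramified outside `S ⊇ ∞ ∪ {v ∣ n} ∪ Ram(M)`
with finite Selmer and dual Selmer groups, `D` a Kolyvagin datum with `𝒫 ∩ S = ∅` and, at the primes
of `𝒫`, the local shape of Rubin Prop. 1.9.5 (1) / Ex. 1.9.7 as BINDERS (`#H¹_ur = #H¹_tr (= p)`,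
`H¹ = H¹_ur + H¹_tr`; not in the tree — "carried by the consumer", `FiniteSingularComparison.lean`).

* §6 `card_selmerGroup_atLevel_insert_mul`, `card_selmerGroup_atLevel_mul` (Rubin Ex. 2.1.4 =
  Mazur–Rubin Cor. 2.3.6 at `m = 1`): `#H¹_{𝓕(d)} · #H¹_{𝓕^*} = #H¹_𝓕 · #H¹_{𝓕(d)^*}` for every
  level `d` — pair counting (file 1, §4) for `𝓕(d) ≤ 𝓕^𝔮(d)` and `𝓕(d𝔮) ≤ 𝓕^𝔮(d)` at each prime of
  `d`, then induction on `d`.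
* §7 `dualSelmerGroup_strictAt_eq` (Cor. 2.6.2 (2), dual form: a class of `H¹_{𝓕(d)}` non-zero at
  `𝔮 ∈ 𝒫` forces `H¹_{𝓕_𝔮(d)^*} = H¹_{𝓕(d)^*}`, the two indices multiplying to the prime
  `p = #H¹_ur(K_𝔮, M)`) and `card_dualSelmerGroup_atLevel_insert_lt` (Cor. 2.6.2 (4), dual half:
  `H¹_{𝓕(d𝔮)^*} ≤ {y ∈ H¹_{𝓕(d)^*} : loc_𝔮 y = 0}` because
  `loc_𝔮 y ∈ (H¹_ur)^* ∩ (H¹_tr)^* = (H¹_ur + H¹_tr)^* = (H¹)^* = 0`; strictly smaller when some dual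
  class is non-zero at `𝔮`, i.e. `λ^*(d𝔮) < λ^*(d)`).

References: [Rubin2011] Ex. 2.1.4, Thm. 2.5.2, Prop. 2.6.1, Cor. 2.6.2 (pp. 18–23) — read (held).
-/

noncomputable section

open scoped Classical NumberField ContRepresentation
open Function NumberField IsDedekindDomain
open Literature.NumberTheory.GaloisRepresentations Literature.NumberTheory.GaloisRepresentations.DiscreteGaloisModule
  Literature.NumberTheory.GaloisCohomology

universe u

namespace Summit.BirchSwinnertonDyer.Rank1Residual.GaloisImage.CoreRankZero

variable {K : Type u} [Field K] [NumberField K] {n : ℕ}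
variable {M : Type u} [AddCommGroup M] [TopologicalSpace M] [DiscreteTopology M] [Finite M]
variable {ρ : DiscreteGaloisModule K M}

/-! ## §6. The core rank is constant along the levels (Rubin Ex. 2.1.4 / Thm. 2.5.2 at `m = 1`) -/

/-- Arithmetic of Rubin's Prop. 2.6.1 (2)–(3) at one prime: from the two relaxed pair countings
`R·B^*·t = B·R^*·T` and `R·C^*·t = C·R^*·T` (with `R^*, T ≠ 0`) follows `B·C^* = C·B^*`.
[folklore] -/
private theorem mul_eq_mul_of_pair {B Bs C Cs R Rs T t : ℕ} (h1 : R * Bs * t = B * Rs * T)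
    (h2 : R * Cs * t = C * Rs * T) (hRs : Rs ≠ 0) (hT : T ≠ 0) : B * Cs = C * Bs := by
  refine mul_right_cancel₀ (mul_ne_zero hRs hT) ?_
  calc B * Cs * (Rs * T) = B * Rs * T * Cs := by ring
    _ = R * Bs * t * Cs := by rw [h1]
    _ = R * Cs * t * Bs := by ring
    _ = C * Rs * T * Bs := by rw [h2]
    _ = C * Bs * (Rs * T) := by ring

omit [Finite M] in
/-- Monotonicity of the Selmer group in the Selmer structure. [folklore] -/
theorem selmerGroup_mono {𝓛 𝓛' : SelmerStructure ρ} (h : 𝓛 ≤ 𝓛') : 𝓛.selmerGroup ≤ 𝓛'.selmerGroup :=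
  fun x hx => (SelmerStructure.mem_selmerGroup_iff 𝓛' x).2 fun v =>
    h v ((SelmerStructure.mem_selmerGroup_iff 𝓛 x).1 hx v)

/-- **One step along the Selmer graph: `#H¹_{𝓕(d)} · #H¹_{𝓕(d𝔮)^*} = #H¹_{𝓕(d𝔮)} · #H¹_{𝓕(d)^*}`**
for a Kolyvagin prime `𝔮 ∉ d` with `#H¹_ur(K_𝔮, M) = #H¹_tr(K_𝔮, M)` — pair counting for
`𝓕(d) ≤ 𝓕^𝔮(d)` and for `𝓕(d𝔮) ≤ 𝓕^𝔮(d)` (Rubin Prop. 2.6.1 (2)–(3)).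
[cite: Rubin2011, Prop. 2.6.1 and Exercise 2.1.4 (pp. 18, 22)] -/
theorem card_selmerGroup_atLevel_insert_mul [NeZero n] {inv : LocalInvariants K n}
    (hperf : inv.IsPerfect) (hsum : inv.SumLocalTermEqZero) (hcompl : inv.SelmerComplement)
    (hM : ∀ m : M, n • m = 0) {S : Finset (Place K)}
    (hS : ∀ v : HeightOneSpectrum (𝓞 K), (Sum.inr v : Place K) ∉ S →
      ((n : ℕ) : 𝓞 K) ∉ v.asIdeal ∧ GaloisRep.IsUnramifiedAt v ρ)
    {𝓕 : SelmerStructure ρ} (h𝓕 : 𝓕.IsUnramifiedOutside S)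
    (hfind : Finite (inv.dualSelmerStructure ρ 𝓕).selmerGroup)
    {D : KolyvaginDatum ρ} (hPS : ∀ q ∈ D.primes, (Sum.inr q : Place K) ∉ S)
    (hUT : ∀ q ∈ D.primes, Nat.card (unramifiedSubgroup (GaloisRep.toLocal q ρ) 1) =
      Nat.card (D.transverse (Sum.inr q)))
    (d : Finset (HeightOneSpectrum (𝓞 K))) {q : HeightOneSpectrum (𝓞 K)} (hq : q ∈ D.primes)
    (hqd : q ∉ d) :
    Nat.card (D.atLevel 𝓕 d).selmerGroup *
        Nat.card (inv.dualSelmerStructure ρ (D.atLevel 𝓕 (insert q d))).selmerGroup =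
      Nat.card (D.atLevel 𝓕 (insert q d)).selmerGroup *
        Nat.card (inv.dualSelmerStructure ρ (D.atLevel 𝓕 d)).selmerGroup := by
  classical
  haveI := DiscreteGaloisModule.TateDual.finite K M n
  -- the enlarged set of places `S' = S ∪ d ∪ {𝔮}`
  let S' : Finset (Place K) := S ∪ (insert q d).map ⟨Sum.inr, Sum.inr_injective⟩
  have hSS' : S ⊆ S' := Finset.subset_union_left
  have hdS' : ∀ r ∈ insert q d, (Sum.inr r : Place K) ∈ S' := fun r hr =>
    Finset.mem_union_right _ (Finset.mem_map.2 ⟨r, hr, rfl⟩)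
  have hq' : (Sum.inr q : Place K) ∈ S' := hdS' q (Finset.mem_insert_self q d)
  have hS' : ∀ v : HeightOneSpectrum (𝓞 K), (Sum.inr v : Place K) ∉ S' →
      ((n : ℕ) : 𝓞 K) ∉ v.asIdeal ∧ GaloisRep.IsUnramifiedAt v ρ :=
    fun v hv => hS v fun h => hv (hSS' h)
  -- the three structures `𝓑 = 𝓕(d)`, `𝓒 = 𝓕(d𝔮)`, `𝓡 = 𝓕^𝔮(d)`
  have h𝓑 : (D.atLevel 𝓕 d).IsUnramifiedOutside S' :=
    Level.isUnramifiedOutside_atLevel D 𝓕 h𝓕 d hSS' fun r hr => hdS' r (Finset.mem_insert_of_mem hr)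
  have h𝓒 : (D.atLevel 𝓕 (insert q d)).IsUnramifiedOutside S' :=
    Level.isUnramifiedOutside_atLevel D 𝓕 h𝓕 (insert q d) hSS' hdS'
  have hRB : ∀ v : Place K, v ≠ Sum.inr q → (D.atLevel 𝓕 d).relaxedAt {q} v = D.atLevel 𝓕 d v :=
    fun v hv => Level.relaxedAt_apply_of_ne _ q hv
  have h𝓡 : ((D.atLevel 𝓕 d).relaxedAt {q}).IsUnramifiedOutside S' :=
    Level.isUnramifiedOutside_of_apply_eq_of_ne h𝓑 q hq' hRB
  have hBR : D.atLevel 𝓕 d ≤ (D.atLevel 𝓕 d).relaxedAt {q} := fun v => by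
    by_cases hv : v = Sum.inr q
    · subst hv; rw [Level.relaxedAt_inr_self]; exact le_top
    · rw [hRB v hv]
  have hCR : D.atLevel 𝓕 (insert q d) ≤ (D.atLevel 𝓕 d).relaxedAt {q} := fun v => by
    by_cases hv : v = Sum.inr q
    · subst hv; rw [Level.relaxedAt_inr_self]; exact le_top
    · rw [hRB v hv, Level.atLevel_insert_apply_of_ne D 𝓕 q hv]
  have heqBR : ∀ v : Place K, v ≠ Sum.inr q → D.atLevel 𝓕 d v = (D.atLevel 𝓕 d).relaxedAt {q} v :=
    fun v hv => (hRB v hv).symm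
  have heqCR : ∀ v : Place K, v ≠ Sum.inr q →
      D.atLevel 𝓕 (insert q d) v = (D.atLevel 𝓕 d).relaxedAt {q} v :=
    fun v hv => by rw [Level.atLevel_insert_apply_of_ne D 𝓕 q hv, hRB v hv]
  -- finiteness of `H¹_{𝓡^*}` (for the cancellation below)
  have hfRd := finite_dualSelmerGroup_of_eq_atLevel_off inv D 𝓕 hfind d q hRB
  -- pair counting twice
  have R1 := card_selmerGroup_pair_one_place hperf hsum hcompl hM hS' hBR h𝓑 h𝓡 q hq' heqBR
  have R2 := card_selmerGroup_pair_one_place hperf hsum hcompl hM hS' hCR h𝓒 h𝓡 q hq' heqCR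
  -- the local indices: `#𝓕(d)_𝔮 = #H¹_ur = #H¹_tr = #𝓕(d𝔮)_𝔮`
  have ht : Nat.card (D.atLevel 𝓕 (insert q d) (Sum.inr q)) = Nat.card (D.atLevel 𝓕 d (Sum.inr q)) := by
    rw [Level.atLevel_insert_inr_self, Level.atLevel_inr_of_not_mem D 𝓕 hqd, h𝓕.2 q (hPS q hq)]
    exact (hUT q hq).symm
  rw [ht] at R2
  -- non-vanishing of `#H¹_{𝓡^*}` and `#H¹(K_𝔮, M)`
  have hRs : Nat.card (inv.dualSelmerStructure ρ ((D.atLevel 𝓕 d).relaxedAt {q})).selmerGroup ≠ 0 :=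
    Nat.card_pos.ne'
  haveI : Finite (((D.atLevel 𝓕 d).relaxedAt {q}) (Sum.inr q)) := by
    haveI := finite_galoisCohomology_one_toLocal ρ q
    infer_instance
  have hT : Nat.card (((D.atLevel 𝓕 d).relaxedAt {q}) (Sum.inr q)) ≠ 0 := Nat.card_pos.ne'
  exact mul_eq_mul_of_pair R1 R2 hRs hT

/-- **`#H¹_{𝓕(d)} · #H¹_{𝓕^*} = #H¹_𝓕 · #H¹_{𝓕(d)^*}` for every level `d`** — the difference
`λ(d) − λ^*(d)` does not depend on `d` (Rubin, Exercise 2.1.4 = Mazur–Rubin Cor. 2.3.6, at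
`m = 1`), from pair counting at the primes of `d` and `#H¹_ur(K_𝔮, M) = #H¹_tr(K_𝔮, M)` for
`𝔮 ∈ 𝒫` (Rubin Ex. 1.9.7). [cite: Rubin2011, Exercise 2.1.4 (p. 18)] -/
theorem card_selmerGroup_atLevel_mul [NeZero n] {inv : LocalInvariants K n}
    (hperf : inv.IsPerfect) (hsum : inv.SumLocalTermEqZero) (hcompl : inv.SelmerComplement)
    (hM : ∀ m : M, n • m = 0) {S : Finset (Place K)}
    (hS : ∀ v : HeightOneSpectrum (𝓞 K), (Sum.inr v : Place K) ∉ S →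
      ((n : ℕ) : 𝓞 K) ∉ v.asIdeal ∧ GaloisRep.IsUnramifiedAt v ρ)
    {𝓕 : SelmerStructure ρ} (h𝓕 : 𝓕.IsUnramifiedOutside S)
    (hfin : Finite 𝓕.selmerGroup) (hfind : Finite (inv.dualSelmerStructure ρ 𝓕).selmerGroup)
    {D : KolyvaginDatum ρ} (hPS : ∀ q ∈ D.primes, (Sum.inr q : Place K) ∉ S)
    (hUT : ∀ q ∈ D.primes, Nat.card (unramifiedSubgroup (GaloisRep.toLocal q ρ) 1) =
      Nat.card (D.transverse (Sum.inr q)))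
    {d : Finset (HeightOneSpectrum (𝓞 K))} (hd : D.IsLevel d) :
    Nat.card (D.atLevel 𝓕 d).selmerGroup * Nat.card (inv.dualSelmerStructure ρ 𝓕).selmerGroup =
      Nat.card 𝓕.selmerGroup * Nat.card (inv.dualSelmerStructure ρ (D.atLevel 𝓕 d)).selmerGroup := by
  classical
  induction d using Finset.induction_on with
  | empty =>
    have h0 : D.atLevel 𝓕 ∅ = 𝓕 := SelmerStructure.modify_empty 𝓕 D.transverse
    rw [h0, mul_comm]
  | insert q d hqd ih =>
    have hd' : D.IsLevel d ∧ q ∈ D.primes := by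
      simp only [KolyvaginDatum.IsLevel, Finset.coe_insert, Set.insert_subset_iff] at hd
      exact ⟨hd.2, hd.1⟩
    have step := card_selmerGroup_atLevel_insert_mul hperf hsum hcompl hM hS h𝓕 hfind hPS hUT d
      hd'.2 hqd
    have ih' := ih hd'.1
    haveI := finite_selmerGroup_atLevel D 𝓕 hfin d
    haveI := finite_dualSelmerGroup_atLevel inv D 𝓕 hfind d
    have hB : Nat.card (D.atLevel 𝓕 d).selmerGroup ≠ 0 := Nat.card_pos.ne'
    have hBs : Nat.card (inv.dualSelmerStructure ρ (D.atLevel 𝓕 d)).selmerGroup ≠ 0 := Nat.card_pos.ne'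
    refine mul_right_cancel₀ (mul_ne_zero hB hBs) ?_
    calc Nat.card (D.atLevel 𝓕 (insert q d)).selmerGroup *
          Nat.card (inv.dualSelmerStructure ρ 𝓕).selmerGroup *
          (Nat.card (D.atLevel 𝓕 d).selmerGroup *
            Nat.card (inv.dualSelmerStructure ρ (D.atLevel 𝓕 d)).selmerGroup)
        = (Nat.card (D.atLevel 𝓕 d).selmerGroup * Nat.card (inv.dualSelmerStructure ρ 𝓕).selmerGroup) *
          (Nat.card (D.atLevel 𝓕 (insert q d)).selmerGroup *
            Nat.card (inv.dualSelmerStructure ρ (D.atLevel 𝓕 d)).selmerGroup) := by ring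
      _ = (Nat.card 𝓕.selmerGroup * Nat.card (inv.dualSelmerStructure ρ (D.atLevel 𝓕 d)).selmerGroup) *
          (Nat.card (D.atLevel 𝓕 d).selmerGroup *
            Nat.card (inv.dualSelmerStructure ρ (D.atLevel 𝓕 (insert q d))).selmerGroup) := by
          rw [ih', step]
      _ = Nat.card 𝓕.selmerGroup *
          Nat.card (inv.dualSelmerStructure ρ (D.atLevel 𝓕 (insert q d))).selmerGroup *
          (Nat.card (D.atLevel 𝓕 d).selmerGroup *
            Nat.card (inv.dualSelmerStructure ρ (D.atLevel 𝓕 d)).selmerGroup) := by ring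

/-! ## §7. Stepping from `d` to `d𝔮` (Rubin Prop. 2.6.1 / Cor. 2.6.2 at `m = 1`, dual side) -/

/-- **If some class of `H¹_{𝓕(d)}(K, M)` is non-zero at `𝔮 ∈ 𝒫` then
`H¹_{𝓕_𝔮(d)^*}(K, M^D) = H¹_{𝓕(d)^*}(K, M^D)`** (every dual Selmer class with no condition at `𝔮`
is automatically orthogonal to `H¹_ur(K_𝔮, M)` there): Rubin Prop. 2.6.1 with `c = 1` forces
`c^* = 0` by `c + c^* = m = 1`, the index identity `[H¹_{𝓕(d)} : H¹_{𝓕_𝔮(d)}] · [H¹_{𝓕_𝔮(d)^*} : H¹_{𝓕(d)^*}] = #H¹_ur(K_𝔮, M) = p`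
being pair counting at `𝔮`. [cite: Rubin2011, Prop. 2.6.1 (3) and Cor. 2.6.2 (2) (p. 22)] -/
theorem dualSelmerGroup_strictAt_eq {p : ℕ} [Fact p.Prime] {inv : LocalInvariants K p}
    (hperf : inv.IsPerfect) (hsum : inv.SumLocalTermEqZero) (hcompl : inv.SelmerComplement)
    (hM : ∀ m : M, p • m = 0) {S : Finset (Place K)}
    (hS : ∀ v : HeightOneSpectrum (𝓞 K), (Sum.inr v : Place K) ∉ S →
      ((p : ℕ) : 𝓞 K) ∉ v.asIdeal ∧ GaloisRep.IsUnramifiedAt v ρ)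
    {𝓕 : SelmerStructure ρ} (h𝓕 : 𝓕.IsUnramifiedOutside S)
    (hfin : Finite 𝓕.selmerGroup) (hfind : Finite (inv.dualSelmerStructure ρ 𝓕).selmerGroup)
    {D : KolyvaginDatum ρ} (hPS : ∀ q ∈ D.primes, (Sum.inr q : Place K) ∉ S)
    (hU : ∀ q ∈ D.primes, Nat.card (unramifiedSubgroup (GaloisRep.toLocal q ρ) 1) = p)
    (d : Finset (HeightOneSpectrum (𝓞 K))) {q : HeightOneSpectrum (𝓞 K)}
    (hq : q ∈ D.primes) (hqd : q ∉ d) {x : galoisCohomology ρ 1}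
    (hx : x ∈ (D.atLevel 𝓕 d).selmerGroup)
    (hxq : galoisCohomology.localization ρ (Sum.inr q) 1 x ≠ 0) :
    (inv.dualSelmerStructure ρ ((D.atLevel 𝓕 d).strictAt {q})).selmerGroup =
      (inv.dualSelmerStructure ρ (D.atLevel 𝓕 d)).selmerGroup := by
  classical
  haveI := DiscreteGaloisModule.TateDual.finite K M p
  have hp : p.Prime := Fact.out
  -- the enlarged set of places `S' = S ∪ d ∪ {𝔮}`
  let S' : Finset (Place K) := S ∪ (insert q d).map ⟨Sum.inr, Sum.inr_injective⟩
  have hSS' : S ⊆ S' := Finset.subset_union_left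
  have hdS' : ∀ r ∈ insert q d, (Sum.inr r : Place K) ∈ S' := fun r hr =>
    Finset.mem_union_right _ (Finset.mem_map.2 ⟨r, hr, rfl⟩)
  have hq' : (Sum.inr q : Place K) ∈ S' := hdS' q (Finset.mem_insert_self q d)
  have hS' : ∀ v : HeightOneSpectrum (𝓞 K), (Sum.inr v : Place K) ∉ S' →
      ((p : ℕ) : 𝓞 K) ∉ v.asIdeal ∧ GaloisRep.IsUnramifiedAt v ρ :=
    fun v hv => hS v fun h => hv (hSS' h)
  -- `𝓐 = 𝓕_𝔮(d) ≤ 𝓑 = 𝓕(d)`, equal off `𝔮`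
  have hAB' : ∀ v : Place K, v ≠ Sum.inr q → (D.atLevel 𝓕 d).strictAt {q} v = D.atLevel 𝓕 d v :=
    fun v hv => Level.strictAt_apply_of_ne _ q hv
  have hAB : (D.atLevel 𝓕 d).strictAt {q} ≤ D.atLevel 𝓕 d := fun v => by
    by_cases hv : v = Sum.inr q
    · subst hv; rw [Level.strictAt_inr_self]; exact bot_le
    · rw [hAB' v hv]
  have h𝓑 : (D.atLevel 𝓕 d).IsUnramifiedOutside S' :=
    Level.isUnramifiedOutside_atLevel D 𝓕 h𝓕 d hSS' fun r hr => hdS' r (Finset.mem_insert_of_mem hr)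
  have h𝓐 : ((D.atLevel 𝓕 d).strictAt {q}).IsUnramifiedOutside S' :=
    Level.isUnramifiedOutside_of_apply_eq_of_ne h𝓑 q hq' hAB'
  have hfB := finite_selmerGroup_atLevel D 𝓕 hfin d
  have hfA := finite_selmerGroup_of_eq_atLevel_off D 𝓕 hfin d q hAB'
  have hfBd := finite_dualSelmerGroup_atLevel inv D 𝓕 hfind d
  have hfAd := finite_dualSelmerGroup_of_eq_atLevel_off inv D 𝓕 hfind d q hAB'
  -- pair counting: `#H¹_𝓑 · #H¹_{𝓐^*} · #𝓐_𝔮 = #H¹_𝓐 · #H¹_{𝓑^*} · #𝓑_𝔮`, `#𝓐_𝔮 = 1`, `#𝓑_𝔮 = p`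
  have P := card_selmerGroup_pair_one_place hperf hsum hcompl hM hS' hAB h𝓐 h𝓑 q hq' hAB'
  have hAq : Nat.card (((D.atLevel 𝓕 d).strictAt {q}) (Sum.inr q)) = 1 := by
    rw [Level.strictAt_inr_self, AddSubgroup.card_bot]
  have hBq : Nat.card (D.atLevel 𝓕 d (Sum.inr q)) = p := by
    rw [Level.atLevel_inr_of_not_mem D 𝓕 hqd, h𝓕.2 q (hPS q hq)]; exact hU q hq
  rw [hAq, hBq, mul_one] at P
  -- Lagrange: `#H¹_𝓑 = i · #H¹_𝓐`, `#H¹_{𝓐^*} = j · #H¹_{𝓑^*}`, so `i · j = p`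
  have hleSel : ((D.atLevel 𝓕 d).strictAt {q}).selmerGroup ≤ (D.atLevel 𝓕 d).selmerGroup :=
    selmerGroup_mono hAB
  have hleDual : (inv.dualSelmerStructure ρ (D.atLevel 𝓕 d)).selmerGroup ≤
      (inv.dualSelmerStructure ρ ((D.atLevel 𝓕 d).strictAt {q})).selmerGroup :=
    LocalInvariants.selmerGroup_dualSelmerStructure_anti inv ρ hAB
  obtain ⟨i, hi⟩ := AddSubgroup.card_dvd_of_le hleSel
  obtain ⟨j, hj⟩ := AddSubgroup.card_dvd_of_le hleDual
  rw [hi, hj] at P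
  have hA0 : Nat.card ((D.atLevel 𝓕 d).strictAt {q}).selmerGroup ≠ 0 := Nat.card_pos.ne'
  have hBs0 : Nat.card (inv.dualSelmerStructure ρ (D.atLevel 𝓕 d)).selmerGroup ≠ 0 :=
    Nat.card_pos.ne'
  have hij : i * j = p := by
    refine mul_left_cancel₀ (mul_ne_zero hA0 hBs0) ?_
    calc Nat.card ((D.atLevel 𝓕 d).strictAt {q}).selmerGroup *
          Nat.card (inv.dualSelmerStructure ρ (D.atLevel 𝓕 d)).selmerGroup * (i * j)
        = Nat.card ((D.atLevel 𝓕 d).strictAt {q}).selmerGroup * i *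
          (Nat.card (inv.dualSelmerStructure ρ (D.atLevel 𝓕 d)).selmerGroup * j) := by ring
      _ = _ := P
      _ = _ := by ring
  -- `i ≠ 1` because `x ∈ H¹_𝓑 ∖ H¹_𝓐`
  have hx𝓐 : x ∉ ((D.atLevel 𝓕 d).strictAt {q}).selmerGroup := fun h => by
    have := (SelmerStructure.mem_selmerGroup_iff _ _).1 h (Sum.inr q)
    rw [Level.strictAt_inr_self, AddSubgroup.mem_bot] at this
    exact hxq this
  have hi1 : i ≠ 1 := by
    rintro rfl
    rw [mul_one] at hi
    exact hx𝓐 ((AddSubgroup.eq_of_le_of_card_ge hleSel hi.le).symm ▸ hx)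
  have hip : i = p := (hp.eq_one_or_self_of_dvd i (Dvd.intro j hij)).resolve_left hi1
  have hj1 : j = 1 := by
    rw [hip] at hij
    exact (mul_eq_left₀ hp.ne_zero).1 hij
  rw [hj1, mul_one] at hj
  exact (AddSubgroup.eq_of_le_of_card_ge hleDual hj.le).symm

/-- **The dual Selmer group drops from `d` to `d𝔮`.** If `H¹(K_𝔮, M) = H¹_ur + H¹_tr` at the
Kolyvagin prime `𝔮 ∉ d` (Rubin Prop. 1.9.5 (1)), some class of `H¹_{𝓕(d)}(K, M)` and some class of
`H¹_{𝓕(d)^*}(K, M^D)` are both non-zero at `𝔮`, then `#H¹_{𝓕(d𝔮)^*}(K, M^D) < #H¹_{𝓕(d)^*}(K, M^D)`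
(indeed `H¹_{𝓕(d𝔮)^*} ≤ {y ∈ H¹_{𝓕(d)^*} : loc_𝔮 y = 0}`; Rubin Cor. 2.6.2 (4):
`λ(d𝔮, Ā^*) = λ(d, Ā^*) − 1`). [cite: Rubin2011, Cor. 2.6.2 (4) (p. 23)] -/
theorem card_dualSelmerGroup_atLevel_insert_lt {p : ℕ} [Fact p.Prime] {inv : LocalInvariants K p}
    (hperf : inv.IsPerfect) (hsum : inv.SumLocalTermEqZero) (hcompl : inv.SelmerComplement)
    (hM : ∀ m : M, p • m = 0) {S : Finset (Place K)}
    (hS : ∀ v : HeightOneSpectrum (𝓞 K), (Sum.inr v : Place K) ∉ S →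
      ((p : ℕ) : 𝓞 K) ∉ v.asIdeal ∧ GaloisRep.IsUnramifiedAt v ρ)
    {𝓕 : SelmerStructure ρ} (h𝓕 : 𝓕.IsUnramifiedOutside S)
    (hfin : Finite 𝓕.selmerGroup) (hfind : Finite (inv.dualSelmerStructure ρ 𝓕).selmerGroup)
    {D : KolyvaginDatum ρ} (hPS : ∀ q ∈ D.primes, (Sum.inr q : Place K) ∉ S)
    (hU : ∀ q ∈ D.primes, Nat.card (unramifiedSubgroup (GaloisRep.toLocal q ρ) 1) = p)
    (hUT : ∀ q ∈ D.primes,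
      unramifiedSubgroup (GaloisRep.toLocal q ρ) 1 ⊔ D.transverse (Sum.inr q) = ⊤)
    (d : Finset (HeightOneSpectrum (𝓞 K))) {q : HeightOneSpectrum (𝓞 K)}
    (hq : q ∈ D.primes) (hqd : q ∉ d) {x : galoisCohomology ρ 1}
    (hx : x ∈ (D.atLevel 𝓕 d).selmerGroup)
    (hxq : galoisCohomology.localization ρ (Sum.inr q) 1 x ≠ 0)
    {y : galoisCohomology (ρ.tateDual p) 1}
    (hy : y ∈ (inv.dualSelmerStructure ρ (D.atLevel 𝓕 d)).selmerGroup)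
    (hyq : galoisCohomology.localization (ρ.tateDual p) (Sum.inr q) 1 y ≠ 0) :
    Nat.card (inv.dualSelmerStructure ρ (D.atLevel 𝓕 (insert q d))).selmerGroup <
      Nat.card (inv.dualSelmerStructure ρ (D.atLevel 𝓕 d)).selmerGroup := by
  classical
  haveI := DiscreteGaloisModule.TateDual.finite K M p
  have hEq := dualSelmerGroup_strictAt_eq hperf hsum hcompl hM hS h𝓕 hfin hfind hPS hU d hq hqd hx hxq
  haveI hfBd := finite_dualSelmerGroup_atLevel inv D 𝓕 hfind d
  -- `Z = {y ∈ H¹_{𝓕(d)^*} : loc_𝔮 y = 0}`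
  let Z : AddSubgroup (galoisCohomology (ρ.tateDual p) 1) :=
    (inv.dualSelmerStructure ρ (D.atLevel 𝓕 d)).selmerGroup ⊓
      (galoisCohomology.localization (ρ.tateDual p) (Sum.inr q) 1).ker
  have hZle : Z ≤ (inv.dualSelmerStructure ρ (D.atLevel 𝓕 d)).selmerGroup := inf_le_left
  haveI : Finite Z := Finite.of_injective _ (AddSubgroup.inclusion_injective hZle)
  -- `H¹_ur ⊔ H¹_tr = H¹(K_𝔮, M)`, read among the subgroups of `H¹(K_𝔮, M)` presented as `ρ.toLocal`
  have hUT' : (max (unramifiedSubgroup (GaloisRep.toLocal q ρ) 1) (D.transverse (Sum.inr q)) :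
      AddSubgroup (galoisCohomology (ρ.toLocal (Sum.inr q)) 1)) = ⊤ := hUT q hq
  -- `H¹_{𝓕(d𝔮)^*} ≤ Z`
  have hCZ : (inv.dualSelmerStructure ρ (D.atLevel 𝓕 (insert q d))).selmerGroup ≤ Z := by
    intro z hz
    -- `z` lies in `H¹_{𝓕_𝔮(d)^*}` (no condition at `𝔮`), hence in `H¹_{𝓕(d)^*}`
    have hzA : z ∈ (inv.dualSelmerStructure ρ ((D.atLevel 𝓕 d).strictAt {q})).selmerGroup := by
      refine mem_selmerGroup_of_forall_ne q (fun v hv => le_of_eq ?_) hz ?_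
      · rw [LocalInvariants.dualSelmerStructure_apply, LocalInvariants.dualSelmerStructure_apply,
          Level.atLevel_insert_apply_of_ne D 𝓕 q hv, Level.strictAt_apply_of_ne _ q hv]
      · rw [LocalInvariants.dualSelmerStructure_apply, Level.strictAt_inr_self,
          LocalInvariants.dualLocalCondition_bot]
        exact AddSubgroup.mem_top _
    rw [hEq] at hzA
    refine ⟨hzA, (AddMonoidHom.mem_ker).2 ?_⟩
    -- at `𝔮`: `loc_𝔮 z ∈ (H¹_ur)^* ⊓ (H¹_tr)^* = (H¹_ur ⊔ H¹_tr)^* = 0`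
    have h1 := (SelmerStructure.mem_selmerGroup_iff _ _).1 hzA (Sum.inr q)
    rw [LocalInvariants.dualSelmerStructure_apply, Level.atLevel_inr_of_not_mem D 𝓕 hqd,
      h𝓕.2 q (hPS q hq)] at h1
    have h2 := (SelmerStructure.mem_selmerGroup_iff _ _).1 hz (Sum.inr q)
    rw [LocalInvariants.dualSelmerStructure_apply, Level.atLevel_insert_inr_self] at h2
    have h12 : galoisCohomology.localization (ρ.tateDual p) (Sum.inr q) 1 z ∈
        inv.dualLocalCondition ρ (Sum.inr q) (unramifiedSubgroup (GaloisRep.toLocal q ρ) 1) ⊓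
          inv.dualLocalCondition ρ (Sum.inr q) (D.transverse (Sum.inr q)) :=
      AddSubgroup.mem_inf.2 ⟨h1, h2⟩
    rw [← dualLocalCondition_sup, hUT', dualLocalCondition_top_of_isPerfect hperf ρ hM q,
      AddSubgroup.mem_bot] at h12
    exact h12
  -- `y ∈ H¹_{𝓕(d)^*} ∖ Z`, so `#Z < #H¹_{𝓕(d)^*}`
  have hyZ : y ∉ Z := fun h => hyq ((AddMonoidHom.mem_ker).1 h.2)
  have hZlt : Nat.card Z < Nat.card (inv.dualSelmerStructure ρ (D.atLevel 𝓕 d)).selmerGroup := by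
    refine lt_of_le_of_ne (AddSubgroup.card_le_of_le hZle) fun h => hyZ ?_
    rw [AddSubgroup.eq_of_le_of_card_ge hZle h.ge]
    exact hy
  exact lt_of_le_of_lt (AddSubgroup.card_le_of_le hCZ) hZlt

end Summit.BirchSwinnertonDyer.Rank1Residual.GaloisImage.CoreRankZero

end
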